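import Mathlib
import HarnessLib
import Literature.Combinatorics.Additive.StepBeyondKempermanTypes
import Literature.Combinatorics.Additive.StepBeyondKempermanUniqueSums

/-!
# Grynkiewicz 2009, Theorem 4.1: the sumset of a decomposition of Theorem 4.1 is quasi-periodic with
# the same quasi-period — so under (45) the quasi-period «must be `G`»

[cite: Grynkiewicz2009, Thm 4.1 and §6 (Claim 9, Subcases 2, 4)] [tag: critical-pair] [tag: inverse-theorem]

Topic `Literature/Combinatorics/Additive`.  Cell `mm-stpp` (D-0046), seat `mm-stpp-lit` (gen 24); the
port of D. J. Grynkiewicz, *A step beyond Kemperman's structure theorem*, Mathematika **55** (2009)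
67–114 continued.  For the decompositions `A = A₁ ∪ A₀`, `B = B₁ ∪ B₀` of the second alternative of
Theorem 4.1 (the tree's `IsGrynkiewiczDecomp H A B A₁ A₀ B₁ B₀`, `StepBeyondKempermanTypes.lean`) the
sumset splits exactly as for a Kemperman decomposition (Kemperman 1960, Thm 5.1, sufficiency; the tree's
`IsKempermanDecompI.isQuasiPeriodicDecomp_add`, whose proofs are followed verbatim here — only conditions
(i) and (ii) are used, not the type of the bottom pair): `A + B = ((A₁ + B) ∪ (A₀ + B₁)) ∪ (A₀ + B₀)`, the
first part `H`-periodic, the second inside one `H`-coset met by no element of the first.  Consequently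
(`IsGrynkiewiczDecomp.eq_top_of_not_isQuasiPeriodic_add`): if `A + B` is NOT quasi-periodic — display (45)
of §6 — both periodic parts are empty, and if moreover `A ∋ 0` generates `G`, the quasi-period is `G`; this
is the form in which §6 repeatedly says «the quasi-period … must be `G`» when the induction hypothesis (the
theorem for a smaller pair) returns a decomposition (Subcase 2, p. 31: «Hence in view of Corollary 4.3 —
which we can apply to `(A(e), B(e))` …»; Subcase 4, p. 33).

WHAT THIS FILE IS NOT: no new definitions, no named facts; nothing on the bottom types (V)–(VIII).

## References
* D. J. Grynkiewicz, *A step beyond Kemperman's structure theorem*, Mathematika 55 (2009) 67–114,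
  doi:10.1112/S0025579300000966; Thm 4.1 (p. 10), §6 Subcases 2 and 4 (pp. 31–33) (held
  `paper:doi-10-1112-s0025579300000966`) [cite: Grynkiewicz2009, Thm 4.1].
* J. H. B. Kemperman, *On small sumsets in an abelian group*, Acta Math. 103 (1960) 63–88, Thm 5.1
  (sufficiency) [cite: Kemperman1960, Thm 5.1].
-/

namespace Literature.Combinatorics.Additive

open Finset
open scoped Pointwise

universe u

variable {G : Type u} [AddCommGroup G] [DecidableEq G]

namespace IsGrynkiewiczDecomp

variable {H : AddSubgroup G} {A B A₁ A₀ B₁ B₀ : Finset G}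

/-- `A + B = (A₁ + B) ∪ (A₀ + B₁) ∪ (A₀ + B₀)`. [cite: Kemperman1960, Thm 5.1 (proof, sufficiency)] -/
theorem add_eq (h : IsGrynkiewiczDecomp H A B A₁ A₀ B₁ B₀) :
    A + B = (A₁ + B ∪ (A₀ + B₁)) ∪ (A₀ + B₀) := by
  have hA := h.decomp_left.union_eq
  have hB := h.decomp_right.union_eq
  calc A + B = (A₁ ∪ A₀) + B := by rw [hA]
    _ = A₁ + B ∪ (A₀ + B) := union_add
    _ = A₁ + B ∪ (A₀ + (B₁ ∪ B₀)) := by rw [hB]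
    _ = _ := by rw [add_union, union_assoc]

/-- The part `(A₁ + B) ∪ (A₀ + B₁)` of `A + B` is `H`-periodic. [cite: Kemperman1960, Thm 5.1 (proof)] -/
theorem isPeriodicWith_part (h : IsGrynkiewiczDecomp H A B A₁ A₀ B₁ B₀) :
    IsPeriodicWith H (A₁ + B ∪ (A₀ + B₁)) :=
  (h.decomp_left.periodic.add_right B).union (h.decomp_right.periodic.add_left A₀)

/-- By (i) of Theorem 4.1, no element of `(A₁ + B) ∪ (A₀ + B₁)` is congruent modulo `H` to an element of
`A₀ + B₀`. [cite: Grynkiewicz2009, Thm 4.1 (i)] -/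
theorem sub_notMem (h : IsGrynkiewiczDecomp H A B A₁ A₀ B₁ B₀) {p c : G}
    (hp : p ∈ A₁ + B ∪ (A₀ + B₁)) (hc : c ∈ A₀ + B₀) : p - c ∉ H := by
  intro hpc
  obtain ⟨a₀, ha₀, b₀, hb₀, rfl⟩ := mem_add.1 hc
  rcases mem_union.1 hp with hp | hp
  · obtain ⟨a₁, ha₁, b, hb, rfl⟩ := mem_add.1 hp
    exact h.decomp_left.sub_notMem ha₁ ha₀
      (h.quot_unique a₁ (h.decomp_left.left_subset ha₁) b hb a₀ ha₀ b₀ hb₀ hpc).1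
  · obtain ⟨a, ha, b₁, hb₁, rfl⟩ := mem_add.1 hp
    exact h.decomp_right.sub_notMem hb₁ hb₀
      (h.quot_unique a (h.decomp_left.right_subset ha) b₁ (h.decomp_right.left_subset hb₁)
        a₀ ha₀ b₀ hb₀ hpc).2

/-- The two parts of `A + B` are disjoint. [cite: Kemperman1960, Thm 5.1 (proof, sufficiency)] -/
theorem disjoint_parts (h : IsGrynkiewiczDecomp H A B A₁ A₀ B₁ B₀) :
    Disjoint (A₁ + B ∪ (A₀ + B₁)) (A₀ + B₀) :=
  disjoint_left.2 fun _ hp hc => h.sub_notMem hp hc (by rw [sub_self]; exact H.zero_mem)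

/-- `A₀ + B₀` lies inside one `H`-coset. [cite: Grynkiewicz2009, Thm 4.1] -/
theorem sub_mem_of_mem_add (h : IsGrynkiewiczDecomp H A B A₁ A₀ B₁ B₀) :
    ∀ x ∈ A₀ + B₀, ∀ y ∈ A₀ + B₀, x - y ∈ H := by
  intro x hx y hy
  obtain ⟨a, ha, b, hb, rfl⟩ := mem_add.1 hx
  obtain ⟨a', ha', b', hb', rfl⟩ := mem_add.1 hy
  have e : a + b - (a' + b') = (a - a') + (b - b') := by abel
  rw [e]
  exact H.add_mem (h.decomp_left.sub_mem a ha a' ha') (h.decomp_right.sub_mem b hb b' hb')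

/-- `A + B = ((A₁ + B) ∪ (A₀ + B₁)) ∪ (A₀ + B₀)` is a quasi-periodic decomposition with quasi-period `H`.
[cite: Grynkiewicz2009, Thm 4.1] [cite: Kemperman1960, Thm 5.1 (proof, sufficiency)] -/
theorem isQuasiPeriodicDecomp_add (h : IsGrynkiewiczDecomp H A B A₁ A₀ B₁ B₀) :
    IsQuasiPeriodicDecomp H (A + B) (A₁ + B ∪ (A₀ + B₁)) (A₀ + B₀) where
  ne_bot := h.decomp_left.ne_bot
  disjoint := h.disjoint_parts
  union_eq := h.add_eq.symm
  periodic := h.isPeriodicWith_part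
  sub_mem := h.sub_mem_of_mem_add

/-- If one of the periodic parts is nonempty, `A + B` is quasi-periodic (with quasi-period `H`).
[cite: Grynkiewicz2009, Thm 4.1 and §6 (45)] -/
theorem isQuasiPeriodic_add (h : IsGrynkiewiczDecomp H A B A₁ A₀ B₁ B₀) (hne : (A₁ ∪ B₁).Nonempty) :
    IsQuasiPeriodic (A + B) := by
  refine ⟨H, _, _, h.isQuasiPeriodicDecomp_add, ?_⟩
  rw [union_nonempty] at hne ⊢
  rcases hne with hA₁ | hB₁
  · exact Or.inl (hA₁.add (h.right_nonempty.mono h.decomp_right.right_subset))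
  · exact Or.inr (h.left_nonempty.add hB₁)

/-- «the quasi-period … must be `G`»: if `A + B` is not quasi-periodic (display (45)), a decomposition of
Theorem 4.1 for `(A, B)` has empty periodic parts; if moreover `0 ∈ A` and `⟨A⟩ = G`, its quasi-period is
`G`. [cite: Grynkiewicz2009, §6 (Subcase 2, p. 31; Subcase 4, p. 33)] -/
theorem eq_top_of_not_isQuasiPeriodic_add (h : IsGrynkiewiczDecomp H A B A₁ A₀ B₁ B₀)
    (hqp : ¬ IsQuasiPeriodic (A + B)) (h0A : (0 : G) ∈ A)
    (hgen : AddSubgroup.closure (A : Set G) = ⊤) :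
    H = ⊤ ∧ A₁ = ∅ ∧ A₀ = A ∧ B₁ = ∅ ∧ B₀ = B := by
  have hparts : A₁ = ∅ ∧ B₁ = ∅ := by
    by_contra hne
    rw [not_and_or, ← Ne, ← Ne, ← nonempty_iff_ne_empty, ← nonempty_iff_ne_empty] at hne
    apply hqp
    refine h.isQuasiPeriodic_add ?_
    rw [union_nonempty]
    exact hne
  obtain ⟨hA₁, hB₁⟩ := hparts
  have hA₀ : A₀ = A := by
    have := h.decomp_left.union_eq
    rwa [hA₁, empty_union] at this
  have hB₀ : B₀ = B := by
    have := h.decomp_right.union_eq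
    rwa [hB₁, empty_union] at this
  have hHtop : H = ⊤ := by
    refine Grynkiewicz2009.eq_top_of_coset_of_closure_eq_top (a := 0) h0A hgen fun x hx => ?_
    exact h.decomp_left.sub_mem x (by rw [hA₀]; exact hx) 0 (by rw [hA₀]; exact h0A)
  exact ⟨hHtop, hA₁, hA₀, hB₁, hB₀⟩

end IsGrynkiewiczDecomp

end Literature.Combinatorics.Additive
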